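import Mathlib

/-!
# K2-G13 sketch — «Rubin's Tamagawa-free 2-adic quotient `Q(W)` is KEY-RIGID»

Stub-ideation k = 2 (g13) for `stub_heegnerIndexLowerAtTwo` of crux
`Summit.BirchSwinnertonDyer.BirchSwinnertonDyer.Theses.PrintCf2.SplitBadTwoLowerHalfOfFacts`
(stmt-BirchSwinnertonDyer-27851), aimed at the plan's HARDEST (a): EXISTENCE of the S2′ identity
`m_W = 2·(A_W + τ_W − 2 t_W + 2 ℓ_W) + e_A(key)` (LEAD `stub_rubinValueFormula_two_v11`, key
`(d % 2, (d / (2 - d % 2)) % 8)`).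

Dictionary.  For a member `W = A^{(d)}` with a non-torsion `P ∈ W(ℚ)` put
`Q(W) := val_W · Ω_W · ĥ(P) / (L′(W,1) · log_ω(P)²)` (scale-invariant in `P`; Tamagawa- and
torsion-free).  Then S2′-v11 ⟺ `2·v₂ Q(W) = e_A(key W)` on members, so the EXISTENCE half of S2′ is
exactly KEY-RIGIDITY of `W ↦ 2·v₂ Q(W)`; the VALUES of `e_A` are the calibration arm's (M″) business.

This file types the SHAPE of that step and PROVES the glue:
* `key_mul_of_emod_eight_eq_one` — twisting by `t ≡ 1 (mod 8)` preserves the LEAD's key;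
* `rigid_of_equivariant`, `rigid_of_local`, `exists_keyed_of_rigid`, `exists_eA_of_rigid` —
  equivariance / place-ledger ⟹ rigidity ⟹ `∃ e_A` in the LEAD's `ℤ → ℤ → ℤ` shape;
* `bilinear_ratio_indep` — two bilinear forms on a line have a vector-independent ratio (fibre
  transfer of `log²/ĥ` from the Heegner vector to a rational point costs only the direction scalar);
* `padicValNat_two_eq_zero_of_odd` — odd places book no 2-adic digit through norms / `|τ|² = q^f`.
The research inputs are `Prop`-valued INTERFACES (`LocalTypeLedger`, `TwistEquivariance`), not
theorems.  BSD is NOT proved by any of this; neither the crux nor the stub is proved here.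
-/

namespace Summit.BirchSwinnertonDyer.BirchSwinnertonDyer.Cruxes.SplitBadTwoLowerHalfOfFacts.HeegnerIndexTwo.K2G13

/-! ### The LEAD's key and its invariance under `t ≡ 1 (mod 8)` twists -/

/-- The key of S2′-v11: `(d % 2, (d / (2 - d % 2)) % 8)` = the class of the squarefree `d` in
`ℚ₂ˣ/ℚ₂ˣ²` (sign is constant on the rank-one class: `w(A^{(d)}) = χ_{d_K}(−1)` forces `d < 0`). -/
def key (d : ℤ) : ℤ × ℤ := (d % 2, (d / (2 - d % 2)) % 8)

/-- Twisting the parameter by `t ≡ 1 (mod 8)` (so `φ_t = χ_t ∘ N` is trivial at the place `2`,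
and at `∞` when `t > 0`) does not change the key. -/
theorem key_mul_of_emod_eight_eq_one (d t : ℤ) (ht : t % 8 = 1) : key (d * t) = key d := by
  obtain ⟨k, rfl⟩ : ∃ k, t = 8 * k + 1 := ⟨t / 8, by omega⟩
  rcases Int.emod_two_eq_zero_or_one d with h | h
  · -- even `d = 2e`: `d·t = 2e + 16(e k)`, so `(d t)/2 ≡ e (mod 8)`
    obtain ⟨e, rfl⟩ : ∃ e, d = 2 * e := ⟨d / 2, by omega⟩
    have hmul : 2 * e * (8 * k + 1) = 2 * e + 16 * (e * k) := by ring
    rw [hmul]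
    generalize e * k = m
    have h1 : (2 * e + 16 * m) % 2 = 0 := by omega
    have h2 : (2 * e) % 2 = 0 := by omega
    simp only [key, h1, h2]
    norm_num
    omega
  · -- odd `d`: `d·t = d + 8(d k)` and the divisor is `1`
    have hmul : d * (8 * k + 1) = d + 8 * (d * k) := by ring
    rw [hmul]
    generalize d * k = n
    have h1 : (d + 8 * n) % 2 = 1 := by omega
    simp only [key, h1, h]
    norm_num
    try omega

/-- Transitivity shadow for (E): two squarefree parameters with the SAME key differ by a twist that
is trivial at the place `2` — `d₁ d₂ ∈ ℚ₂ˣ²`, i.e. `d₁ d₂ ≡ 1 (mod 8)` or `d₁ d₂ = 4e` with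
`e ≡ 1 (mod 8)` (then `A^{(d₂)} ≅ (A^{(d₁)})^{(d₁ d₂)}` and `φ_{d₁d₂}` is unramified-trivial at `2`;
at `∞` it is trivial because every rank-one member has `d < 0`). -/
theorem twist_trivial_at_two (d₁ d₂ : ℤ) (h₁ : Squarefree d₁) (h₂ : Squarefree d₂)
    (hk : key d₁ = key d₂) :
    (d₁ * d₂) % 8 = 1 ∨ ∃ e : ℤ, d₁ * d₂ = 4 * e ∧ e % 8 = 1 := by
  simp only [key, Prod.mk.injEq] at hk
  obtain ⟨hpar, hcls⟩ := hk
  rcases Int.emod_two_eq_zero_or_one d₁ with hp | hp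
  · -- both even: `dᵢ = 2eᵢ` with `eᵢ` odd (squarefree) and `e₁ ≡ e₂ (mod 8)`
    have hp2 : d₂ % 2 = 0 := by omega
    obtain ⟨e₁, rfl⟩ : ∃ e, d₁ = 2 * e := ⟨d₁ / 2, by omega⟩
    obtain ⟨e₂, rfl⟩ : ∃ e, d₂ = 2 * e := ⟨d₂ / 2, by omega⟩
    have ho₁ : e₁ % 2 = 1 := by
      by_contra hc
      have hdvd : (2 : ℤ) * 2 ∣ 2 * e₁ := ⟨e₁ / 2, by omega⟩
      exact absurd (h₁ 2 hdvd) (by norm_num [Int.isUnit_iff])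
    have ho₂ : e₂ % 2 = 1 := by
      by_contra hc
      have hdvd : (2 : ℤ) * 2 ∣ 2 * e₂ := ⟨e₂ / 2, by omega⟩
      exact absurd (h₂ 2 hdvd) (by norm_num [Int.isUnit_iff])
    have hs1 : 2 * e₁ % 2 = 0 := by omega
    have hs2 : 2 * e₂ % 2 = 0 := by omega
    have hd1 : 2 * e₁ / (2 - 0) = e₁ := by omega
    have hd2 : 2 * e₂ / (2 - 0) = e₂ := by omega
    rw [hs1, hs2, hd1, hd2] at hcls
    right
    refine ⟨e₁ * e₂, by ring, ?_⟩
    have hr : e₁ % 8 = 1 ∨ e₁ % 8 = 3 ∨ e₁ % 8 = 5 ∨ e₁ % 8 = 7 := by omega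
    have hm : e₁ * e₂ % 8 = e₁ % 8 * (e₂ % 8) % 8 := Int.mul_emod e₁ e₂ 8
    rw [hm, ← hcls]
    rcases hr with h | h | h | h <;> simp [h]
  · -- both odd: `d₁ ≡ d₂ (mod 8)` and an odd square is `1 (mod 8)`
    have hp2 : d₂ % 2 = 1 := by omega
    have hd1 : d₁ / (2 - 1) = d₁ := by omega
    have hd2 : d₂ / (2 - 1) = d₂ := by omega
    rw [hp, hp2, hd1, hd2] at hcls
    left
    have hr : d₁ % 8 = 1 ∨ d₁ % 8 = 3 ∨ d₁ % 8 = 5 ∨ d₁ % 8 = 7 := by omega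
    have hm : d₁ * d₂ % 8 = d₁ % 8 * (d₂ % 8) % 8 := Int.mul_emod d₁ d₂ 8
    rw [hm, ← hcls]
    rcases hr with h | h | h | h <;> simp [h]

/-! ### Rigidity from equivariance or from a place ledger; existence of a keyed `e_A` -/

/-- KEY-RIGIDITY of an invariant `Q` (think `Q W = 2·v₂ Q(W)`) with respect to a key map `κ`. -/
def KeyRigid {Member Key : Type*} (Q : Member → ℤ) (κ : Member → Key) : Prop :=
  ∀ W₁ W₂, κ W₁ = κ W₂ → Q W₁ = Q W₂

/-- (E) Twist-equivariance ⟹ rigidity: if twists `act t` (squarefree `t ≡ 1 (mod 8)`, `t > 0`,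
`(t,7) = 1`, modulo squares) leave `Q` invariant and act transitively on each key class, `Q` is
key-rigid.  Transitivity is elementary: `t := d₁d₂/gcd(d₁,d₂)²`. -/
theorem rigid_of_equivariant {Member Key T : Type*} (act : T → Member → Member) (Q : Member → ℤ)
    (κ : Member → Key) (hinv : ∀ t W, Q (act t W) = Q W)
    (htrans : ∀ W₁ W₂, κ W₁ = κ W₂ → ∃ t, act t W₁ = W₂) : KeyRigid Q κ := by
  intro W₁ W₂ h
  obtain ⟨t, rfl⟩ := htrans W₁ W₂ h
  exact (hinv t W₁).symm

/-- (L) Place ledger ⟹ rigidity: if `Q W = Σ_{v ∈ S} q v W` over a finite set of "places" and every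
local digit factors through the key, so does `Q`.  The card's ledger is `S = {2, ∞, glob}`: every
ODD place is absent because its digit vanishes identically (Plans 1 and 3). -/
theorem rigid_of_local {Member Key Place : Type*} (S : Finset Place) (q : Place → Member → ℤ)
    (Q : Member → ℤ) (κ : Member → Key) (hsum : ∀ W, Q W = ∑ v ∈ S, q v W)
    (hloc : ∀ v ∈ S, KeyRigid (q v) κ) : KeyRigid Q κ := by
  intro W₁ W₂ h
  rw [hsum, hsum]
  exact Finset.sum_congr rfl (fun v hv => hloc v hv W₁ W₂ h)

/-- Rigidity ⟹ EXISTENCE of a keyed table, with no value computed. -/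
theorem exists_keyed_of_rigid {Member Key : Type*} (Q : Member → ℤ) (κ : Member → Key)
    (rigid : KeyRigid Q κ) : ∃ eA : Key → ℤ, ∀ W, Q W = eA (κ W) := by
  classical
  refine ⟨fun k => if h : ∃ W, κ W = k then Q h.choose else 0, fun W => ?_⟩
  have h : ∃ W', κ W' = κ W := ⟨W, rfl⟩
  dsimp only
  rw [dif_pos h]
  exact rigid W h.choose h.choose_spec.symm

/-- The LEAD's shape: members indexed by admissible twist parameters `d` (predicate `Adm`:
squarefree, `d < 0`, `4 ∣ disc ℚ(√d)`, `r_an = 1`, …), `Q d = 2·v₂ Q(A^{(d)})`; key-rigidity on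
admissible members gives `∃ eA : ℤ → ℤ → ℤ` evaluated at `(d % 2, (d / (2 - d % 2)) % 8)`. -/
theorem exists_eA_of_rigid (Adm : ℤ → Prop) (Q : ℤ → ℤ)
    (rigid : ∀ d₁ d₂, Adm d₁ → Adm d₂ → key d₁ = key d₂ → Q d₁ = Q d₂) :
    ∃ eA : ℤ → ℤ → ℤ, ∀ d, Adm d → Q d = eA (d % 2) ((d / (2 - d % 2)) % 8) := by
  classical
  have hr : KeyRigid (fun W : {d // Adm d} => Q W.1) (fun W => key W.1) :=
    fun W₁ W₂ h => rigid W₁.1 W₂.1 W₁.2 W₂.2 h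
  obtain ⟨e, he⟩ := exists_keyed_of_rigid _ _ hr
  refine ⟨fun a b => e (a, b), fun d hd => ?_⟩
  simpa [key] using he ⟨d, hd⟩

/-! ### Fibre transfer: two bilinear forms on a line -/

/-- (L3) On a line, the ratio of two bilinear forms is vector-independent: for `y₊ = a • x`,
`y₋ = b • x` one has `B₁(y₊,y₋)·B₂(x,x) = B₂(y₊,y₋)·B₁(x,x)`.  With `B₁ = log_ω ⊗ log_ω` and
`B₂ = ⟨·,·⟩_NT` this moves the same-vector quotient from the Heegner vectors to `x = Φ(P_W)`,
`P_W ∈ W(ℚ)`, at the cost of the direction scalars `a, b` only (booked by T3.2's conjugate pair). -/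
theorem bilinear_ratio_indep {R M : Type*} [CommRing R] [AddCommGroup M] [Module R M]
    (B₁ B₂ : M →ₗ[R] M →ₗ[R] R) (x : M) (a b : R) :
    B₁ (a • x) (b • x) * B₂ x x = B₂ (a • x) (b • x) * B₁ x x := by
  simp only [map_smul, LinearMap.smul_apply, smul_eq_mul]
  ring

/-- The rank-one form `ℓ ⊗ ℓ` used for the numerator `log_ω(y₊)·log_ω(y₋)`. -/
def sqForm {R M : Type*} [CommRing R] [AddCommGroup M] [Module R M] (ℓ : M →ₗ[R] R) :
    M →ₗ[R] M →ₗ[R] R :=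
  LinearMap.mk₂ R (fun u v => ℓ u * ℓ v) (fun u₁ u₂ v => by simp [add_mul])
    (fun c u v => by simp [mul_assoc]) (fun u v₁ v₂ => by simp [mul_add])
    (fun c u v => by simp [mul_left_comm])

theorem sqForm_apply {R M : Type*} [CommRing R] [AddCommGroup M] [Module R M] (ℓ : M →ₗ[R] R)
    (u v : M) : sqForm ℓ u v = ℓ u * ℓ v := rfl

/-! ### Odd places book no 2-adic digit -/

/-- `v₂` of an odd natural number is `0`: norms of odd conductors, `|τ(χ_q)|² = q^f`
(Stickelberger: the Gauss sum is supported above `q`), `u₁ = 1`, … contribute nothing at `2`. -/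
theorem padicValNat_two_eq_zero_of_odd (n : ℕ) (hn : Odd n) : padicValNat 2 n = 0 :=
  padicValNat.eq_zero_of_not_dvd fun h => (Nat.not_even_iff_odd.mpr hn) (even_iff_two_dvd.mpr h)

theorem padicValNat_two_pow_mul_pow_eq_zero (q r a b : ℕ) (hq : Odd q) (hr : Odd r) :
    padicValNat 2 (q ^ a * r ^ b) = 0 :=
  padicValNat_two_eq_zero_of_odd _ (hq.pow.mul hr.pow)

/-! ### Research interfaces (NOT proved; the card's K1–K3) -/

/-- **K1 (place ledger of the same-vector quotient).**  Abstract record of the claim that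
`2·v₂ Q(W)` is a finite sum of local digits over `S = {2, ∞, glob}` each of which factors through
the key — assembled from: LZZ18 Thm 1.6/1.8 (interpolation constant place-free except `𝔭 ∣ 2` and
`Ω_ι(χ)`; `α♮` shared with YZZ), CST14 Thm 1.5 + Lemma 2.3 (explicit complex side; unique admissible
order at `7 ∣ (c₁, N)`; `Σ_D = ∅`, `u₁ = 1`), Kings–Sprang Thm 5.24 (`Local(χ,Σ)` depends only on
the `2`-part of the conductor), Stickelberger at odd places, and the fibre transfer above. -/
structure LocalTypeLedger (Member Key Place : Type*) where
  Q : Member → ℤ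
  κ : Member → Key
  S : Finset Place
  q : Place → Member → ℤ
  sum_eq : ∀ W, Q W = ∑ v ∈ S, q v W
  local_rigid : ∀ v ∈ S, KeyRigid (q v) κ

theorem LocalTypeLedger.rigid {Member Key Place : Type*} (L : LocalTypeLedger Member Key Place) :
    KeyRigid L.Q L.κ :=
  rigid_of_local L.S L.q L.Q L.κ L.sum_eq L.local_rigid

theorem LocalTypeLedger.exists_keyed {Member Key Place : Type*}
    (L : LocalTypeLedger Member Key Place) : ∃ eA : Key → ℤ, ∀ W, L.Q W = eA (L.κ W) :=
  exists_keyed_of_rigid _ _ L.rigid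

/-- **K2 (twist-equivariance away from `2·∞`).**  Abstract record: an action of twist parameters
`t` (squarefree, `t ≡ 1 (mod 8)`, `t > 0`, prime to `7`) on members, `Q`-invariant and transitive
on key classes. -/
structure TwistEquivariance (Member Key T : Type*) where
  Q : Member → ℤ
  κ : Member → Key
  act : T → Member → Member
  invariant : ∀ t W, Q (act t W) = Q W
  transitive : ∀ W₁ W₂, κ W₁ = κ W₂ → ∃ t, act t W₁ = W₂

theorem TwistEquivariance.rigid {Member Key T : Type*} (E : TwistEquivariance Member Key T) :
    KeyRigid E.Q E.κ :=
  rigid_of_equivariant E.act E.Q E.κ E.invariant E.transitive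

theorem TwistEquivariance.exists_keyed {Member Key T : Type*} (E : TwistEquivariance Member Key T) :
    ∃ eA : Key → ℤ, ∀ W, E.Q W = eA (E.κ W) :=
  exists_keyed_of_rigid _ _ E.rigid

end Summit.BirchSwinnertonDyer.BirchSwinnertonDyer.Cruxes.SplitBadTwoLowerHalfOfFacts.HeegnerIndexTwo.K2G13
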